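import Literature.Probability.FitznerVanDerHofstad2017.NobleBlocksPrime
import HarnessLib

/-!
# [FvdH17] §5.1 "Elements of the bounds": closed letter forms of the vectors `P⃗^S`, `P⃗^E`, `Σ_ι P^{ι}` and of
the rows `a = 0` of the matrices `A`, `A^ι`, `Ā^ι` (and `Ā^{ι}'`)

Source: R. Fitzner, R. van der Hofstad, *Mean-field behavior for nearest-neighbor percolation in `d > 10`*,
Electron. J. Probab. **22** (2017) no. 43 [FvdH17]; extended version arXiv:1506.07977v2, §5.1 "Elements of
the bounds" (p. 49–50) and App. B, Tables "definition of `P^b(x,y)`", "`P^{ι,b}(x,y)`", "`A^{a,b}(0,v,x,y)`",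
"`A^{ι,a,b}(0,v,x,y)`", "`Ā^{ι,a,b}(0,v,x,y)`" (pp. 73–78).

The elements of the bounds are defined in `BlockSummation` / `BlockComposition` / `NobleBlocks` in the printed
SUP form — `(B)_{a,b} = sup_v Σ_{κ,x,y} B^{κ,a,b}(0,v,x,y)` (`matB`, `matB₀`, norm `normB`) and
`(Ā^ι)_{a,b} = sup_{v,y} Σ_{κ,x} Ā^{κ,a,b}(0,v,x,x+y)` (`matAbar`, norm `normOO`) — over block tables that carry
the Kronecker constraints of App. B as factors `δ = kd`, `1−δ = kdc`.  This module performs, once and for all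
`L : Letters d`, the purely algebraic first step of every entry estimate of §5.4 / App. D ("ELEMENTS ≤ CELLS"):
it sums out the Kronecker deltas and collapses the suprema that the constraints make trivial, producing EXPLICIT
LETTER SUMS (equalities in `ℝ≥0∞`, no inequality, no cell, no numeral):

* (G) generic SUP COLLAPSE: `⨆ v, F v = F 0` when `F v = 0` for `v ≠ 0` (`iSup_eq_apply_zero`); hence
  `normB M = Σ_{x,y} M(0,0,x,y)` and `normOO M = sup_y Σ_x M(0,0,x,x+y)` for a block vanishing off `v = 0`
  (every row `a = 0`: "`⇒ v = 0`", factor `δ_{v,0}`), and `normOO M = Σ_x M(0,0,x,x)` when the block moreover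
  vanishes off the diagonal `y = x` (rows with "`⇒ x = y`", factor `δ_{x,y}`);
* (V) the vectors: `(P⃗^S)_0 = Σ_x P̃(0⇔x)` (`P̃ = pdbc`, `P̃(0)=1`), `(P⃗^S)_1 = Σ_x (1−δ_{0,x})[B_{3,1̲}(x,0) +
  Σ_y (1−δ_{0,y}) T_{1,1̲,1}(x,y,0)]`, `(P⃗^S)_2` likewise with `D_{2,2}`, `T_{1,2,1}`; `(P⃗^E)_0 = (P⃗^S)_0`,
  `(P⃗^E)_1 = Σ_{x,y} (1−δ_{0,x})(1−δ_{0,y}) T_{1,1̲,1}(x,y,0)`, `(P⃗^E)_2` likewise; `Σ_{ι,x,y} P^{ι,0}(x,y) =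
  (Σ_ι τ_3(e_ι)) Σ_x P̃(0⇔x)` and the normalised `(P⃗^ι)_0 = (1/2d)[1 + (Σ_ι τ_3(e_ι)) Σ_x P̃(0⇔x)]`;
* (M) the rows `a = 0`: `(A)_{0,0} = Σ_x (1−δ_{0,x}) P̃(0⇔x)`, `(A)_{0,1} = Σ_{x,y} (1−δ_{0,y}) T_{1,1̲,1}(x,y,0)`,
  `(A)_{0,2} = Σ_{x,y} (1−δ_{0,y})(1−δ_{0,x}) T_{1,2,1}(x,y,0)`; `(A^ι)_{0,b}` (`b = 0,1,2`) as explicit sums;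
  `(Ā^ι)_{0,0} = Σ_x Σ_κ (1−δ_{0,x})(1−δ_{x,e_κ}) T_{1,1̲,1}(e_κ,x,0)` (App. B reading, landed `matAbarIota`) and
  `(Ā^{ι}')_{0,0} = Σ_x Σ_κ (1−δ_{0,x})(1−δ_{x,e_κ}) T_{1̲,1,1}(e_κ,x,0)` (§6.1 reading, `NobleBlocksPrime.
  matAbarIota'`; the D74 pair, both FULLY closed — no supremum survives), and `(Ā^ι)_{0,1}` with the single
  surviving supremum over the out-gap `y`.

Any letter table `L : Letters d`, any `d`; nothing landed is modified; no cited hypothesis — every statement is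
a kernel-proved identity of the landed definitions.
-/

noncomputable section

namespace Literature.Probability.FitznerVanDerHofstad2017.NobleBlocks

open Literature.Probability.LatticeModels Literature.Probability.Percolation
open Literature.Probability.FitznerVanDerHofstad2017.BlockSummation
open scoped BigOperators ENNReal Matrix

local notation "𝐞" => Literature.Probability.Percolation.stepVec

variable {d : ℕ}

/-! ## G. Sup collapse and Kronecker summation -/

/-- A supremum over a pointed index type of a function vanishing off the base point is its value there.
[folklore] -/
theorem iSup_eq_apply_zero {α : Type*} [Zero α] (F : α → ℝ≥0∞) (hF : ∀ v, v ≠ 0 → F v = 0) :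
    ⨆ v, F v = F 0 := by
  refine le_antisymm (iSup_le fun v => ?_) (le_iSup F 0)
  by_cases h : v = 0
  · subst h; exact le_rfl
  · simp [hF v h]

/-- `(M) = Σ_{x,y} M(0,0,x,y)` for a block that vanishes unless `v = 0` (rows `a = 0` of App. B: "`⇒ v = 0`").
[cite: FitznerVanDerHofstad2017, §5.1 "Elements of the bounds" (arXiv:1506.07977v2 p. 49)] -/
theorem normB_eq_of_v_zero (M : Site d → Site d → Site d → Site d → ℝ≥0∞)
    (hv : ∀ v, v ≠ 0 → ∀ x y, M 0 v x y = 0) : normB M = ∑' x, ∑' y, M 0 0 x y :=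
  iSup_eq_apply_zero (fun v => ∑' x, ∑' y, M 0 v x y) fun v h => by simp [hv v h]

/-- `sup_{v,y} Σ_x M(0,v,x,x+y) = sup_y Σ_x M(0,0,x,x+y)` for a block that vanishes unless `v = 0`.
[cite: FitznerVanDerHofstad2017, §5.1 "Elements of the bounds" (arXiv:1506.07977v2 p. 49)] -/
theorem normOO_eq_iSup_of_v_zero (M : Site d → Site d → Site d → Site d → ℝ≥0∞)
    (hv : ∀ v, v ≠ 0 → ∀ x y, M 0 v x y = 0) : normOO M = ⨆ y, ∑' x, M 0 0 x (x + y) :=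
  iSup_eq_apply_zero (fun v => ⨆ y, ∑' x, M 0 v x (x + y)) fun v h => by simp [hv v h]

/-- `sup_{v,y} Σ_x M(0,v,x,x+y) = Σ_x M(0,0,x,x)` for a block that vanishes unless `v = 0` and `y = x` (rows
with "`⇒ x = y, v = 0`"). [cite: FitznerVanDerHofstad2017, §5.1 "Elements of the bounds" (arXiv:1506.07977v2 p. 49)] -/
theorem normOO_eq_tsum_of_v_zero_of_diag (M : Site d → Site d → Site d → Site d → ℝ≥0∞)
    (hv : ∀ v, v ≠ 0 → ∀ x y, M 0 v x y = 0) (hxy : ∀ v x y, y ≠ x → M 0 v x y = 0) :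
    normOO M = ∑' x, M 0 0 x x := by
  rw [normOO_eq_iSup_of_v_zero M hv,
    iSup_eq_apply_zero (fun y => ∑' x, M 0 0 x (x + y)) fun y h => by
      simp [fun x => hxy 0 x (x + y) (by simpa using h)]]
  simp

/-- `Σ_y δ_{y,x} f(y) = f(x)`. [folklore] -/
theorem tsum_kd_mul (x : Site d) (f : Site d → ℝ≥0∞) : ∑' y, kd y x * f y = f x := by
  rw [tsum_eq_single x fun y hy => by simp [kd_of_ne hy]]
  simp

/-- `Σ_y δ_{x,y} f(y) = f(x)`. [folklore] -/
theorem tsum_kd_mul' (x : Site d) (f : Site d → ℝ≥0∞) : ∑' y, kd x y * f y = f x := by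
  rw [tsum_eq_single x fun y hy => by simp [kd_of_ne (Ne.symm hy)]]
  simp

/-- `(1−δ)·δ = 0` at the same pair. [folklore] -/
@[simp] theorem kdc_mul_kd (x y : Site d) : kdc x y * kd x y = 0 := by
  unfold kd kdc; split_ifs <;> simp

/-- `δ·(1−δ) = 0` at the same pair. [folklore] -/
@[simp] theorem kd_mul_kdc (x y : Site d) : kd x y * kdc x y = 0 := by
  unfold kd kdc; split_ifs <;> simp

/-- `(1−δ)·(1−δ) = (1−δ)`. [folklore] -/
@[simp] theorem kdc_mul_kdc (x y : Site d) : kdc x y * kdc x y = kdc x y := by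
  unfold kdc; split_ifs <;> simp

/-! ## V. The vectors `P⃗^S`, `P⃗^E`, `Σ_ι P^ι`, `P⃗^ι` -/

section Vectors

variable (L : Letters d)

/-- `(P⃗^S)_0 = Σ_{x,y} δ_{x,y} P̃(0⇔x) = Σ_x P̃(0⇔x)` (`P̃(0) = 1`, `P̃(x) = P(0⇔x)` else).
[cite: FitznerVanDerHofstad2017, App. B Table "definition of P^b(x,y)", row b = 0 (arXiv:1506.07977v2 p. 73); §5.1 "Elements of the bounds" (p. 49)] -/
theorem vecPS_zero : vecPS L 0 = ∑' x, L.pdbc x := by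
  show ∑' x, ∑' y, blockPS L 0 x y = _
  have h : ∀ x y, blockPS L 0 x y = kd x y * L.pdbc x := fun _ _ => rfl
  simp only [h, ENNReal.tsum_mul_right, tsum_kd, one_mul]

/-- `(P⃗^S)_1 = Σ_x (1−δ_{x,0}) [B_{3,1̲}(x,0) + Σ_y (1−δ_{y,0}) T_{1,1̲,1}(x,y,0)]`.
[cite: FitznerVanDerHofstad2017, App. B Table "definition of P^b(x,y)", row b = 1 (arXiv:1506.07977v2 p. 73); §5.1 "Elements of the bounds" (p. 49)] -/
theorem vecPS_one : vecPS L 1 =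
    ∑' x, kdc x 0 * (L.B (.ge 3) (.eq 1) x 0 + ∑' y, kdc y 0 * L.T (.ge 1) (.eq 1) (.ge 1) x y 0) := by
  show ∑' x, ∑' y, blockPS L 1 x y = _
  have h : ∀ x y, blockPS L 1 x y =
      kdc x 0 * (kd y 0 * L.B (.ge 3) (.eq 1) x 0 + kdc y 0 * L.T (.ge 1) (.eq 1) (.ge 1) x y 0) := fun _ _ => rfl
  refine tsum_congr fun x => ?_
  simp only [h]
  rw [ENNReal.tsum_mul_left, ENNReal.tsum_add, tsum_kd_mul]

/-- `(P⃗^S)_2 = Σ_x (1−δ_{x,0}) [D_{2,2}(x) + Σ_y (1−δ_{y,0}) T_{1,2,1}(x,y,0)]`.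
[cite: FitznerVanDerHofstad2017, App. B Table "definition of P^b(x,y)", row b = 2 (arXiv:1506.07977v2 p. 73); §5.1 "Elements of the bounds" (p. 49)] -/
theorem vecPS_two : vecPS L 2 =
    ∑' x, kdc x 0 * (L.D (.ge 2) (.ge 2) x + ∑' y, kdc y 0 * L.T (.ge 1) (.ge 2) (.ge 1) x y 0) := by
  show ∑' x, ∑' y, blockPS L 2 x y = _
  have h : ∀ x y, blockPS L 2 x y =
      kdc x 0 * (kd y 0 * L.D (.ge 2) (.ge 2) x + kdc y 0 * L.T (.ge 1) (.ge 2) (.ge 1) x y 0) := fun _ _ => rfl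
  refine tsum_congr fun x => ?_
  simp only [h]
  rw [ENNReal.tsum_mul_left, ENNReal.tsum_add, tsum_kd_mul]

/-- `(P⃗^E)_0 = (P⃗^S)_0`. [cite: FitznerVanDerHofstad2017, §5.1 Table "Repulsive triangles P^{S,b} and P^{E,b}" (arXiv:1506.07977v2 p. 47)] -/
theorem vecPE_zero : vecPE L 0 = vecPS L 0 := rfl

/-- `(P⃗^E)_0 = Σ_x P̃(0⇔x)`. [cite: FitznerVanDerHofstad2017, §5.1 "Elements of the bounds" (arXiv:1506.07977v2 p. 49)] -/
theorem vecPE_zero_eq : vecPE L 0 = ∑' x, L.pdbc x := by rw [vecPE_zero, vecPS_zero]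

/-- `(P⃗^E)_1 = Σ_{x,y} (1−δ_{x,0})(1−δ_{y,0}) T_{1,1̲,1}(x,y,0)` (the `δ_{0,y} B_{3,1̲}` term of `P^{S,1}` is killed
by the end-triangle constraint `y ≠ 0`). [cite: FitznerVanDerHofstad2017, §5.1 Table "P^{E,b}" (arXiv:1506.07977v2 p. 47); App. B (p. 73)] -/
theorem vecPE_one : vecPE L 1 = ∑' x, ∑' y, kdc x 0 * kdc y 0 * L.T (.ge 1) (.eq 1) (.ge 1) x y 0 := by
  show ∑' x, ∑' y, blockPE L 1 x y = _
  have h : ∀ x y, blockPE L 1 x y = kdc y 0 *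
      (kdc x 0 * (kd y 0 * L.B (.ge 3) (.eq 1) x 0 + kdc y 0 * L.T (.ge 1) (.eq 1) (.ge 1) x y 0)) := fun _ _ => rfl
  refine tsum_congr fun x => tsum_congr fun y => ?_
  rw [h]
  by_cases hy : y = 0
  · subst hy; simp
  · simp [kd_of_ne hy, kdc_of_ne hy]

/-- `(P⃗^E)_2 = Σ_{x,y} (1−δ_{x,0})(1−δ_{y,0}) T_{1,2,1}(x,y,0)`.
[cite: FitznerVanDerHofstad2017, §5.1 Table "P^{E,b}" (arXiv:1506.07977v2 p. 47); App. B (p. 73)] -/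
theorem vecPE_two : vecPE L 2 = ∑' x, ∑' y, kdc x 0 * kdc y 0 * L.T (.ge 1) (.ge 2) (.ge 1) x y 0 := by
  show ∑' x, ∑' y, blockPE L 2 x y = _
  have h : ∀ x y, blockPE L 2 x y = kdc y 0 *
      (kdc x 0 * (kd y 0 * L.D (.ge 2) (.ge 2) x + kdc y 0 * L.T (.ge 1) (.ge 2) (.ge 1) x y 0)) := fun _ _ => rfl
  refine tsum_congr fun x => tsum_congr fun y => ?_
  rw [h]
  by_cases hy : y = 0
  · subst hy; simp
  · simp [kd_of_ne hy, kdc_of_ne hy]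

/-- `Σ_{ι,x,y} P^{ι,0}(x,y) = (Σ_ι τ_3(e_ι)) · Σ_x P̃(0⇔x)` (row `b = 0`: `δ_{x,y} τ_{3}(e) P̃(e⇔x)`, the shift
`x ↦ x − e` summed out). [cite: FitznerVanDerHofstad2017, App. B Table "definition of P^{ι,b}(x,y)", row b = 0 (arXiv:1506.07977v2 p. 73); §5.1 "Elements of the bounds" (p. 50)] -/
theorem vecPiotaSum_zero :
    vecPiotaSum L 0 = (∑ ι : Fin d × Bool, L.tau (.ge 3) (𝐞 ι)) * ∑' x, L.pdbc x := by
  show ∑' x, ∑' y, ∑ ι : Fin d × Bool, blockPiota L ι 0 x y = _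
  have h : ∀ ι x y, blockPiota L ι 0 x y = kd x y * L.tau (.ge 3) (𝐞 ι) * L.pdbc (x - 𝐞 ι) := fun _ _ _ => rfl
  simp only [h, mul_assoc, ← Finset.mul_sum, tsum_kd_mul']
  rw [tsum_finsetSum, Finset.sum_mul]
  refine Finset.sum_congr rfl fun ι _ => ?_
  rw [ENNReal.tsum_mul_left, tsum_sub_right_eq (fun x => L.pdbc x) (𝐞 ι)]

/-- `(P⃗^ι)_0 = (1/2d)[1 + (Σ_ι τ_3(e_ι)) Σ_x P̃(0⇔x)]`.
[cite: FitznerVanDerHofstad2017, §5.1 "Elements of the bounds", P⃗^ι (arXiv:1506.07977v2 p. 50)] -/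
theorem vecPiota_zero :
    vecPiota L 0 = invTwoD d * (1 + (∑ ι : Fin d × Bool, L.tau (.ge 3) (𝐞 ι)) * ∑' x, L.pdbc x) := by
  show invTwoD d * ((if (0 : Fin 3) = 0 then 1 else 0) + vecPiotaSum L 0) = _
  rw [if_pos rfl, vecPiotaSum_zero]

end Vectors

/-! ## M. The rows `a = 0` of `A`, `A^ι`, `Ā^ι`, `Ā^{ι}'` -/

section Rows

variable (L : Letters d)

/-- `(A)_{0,0} = Σ_x (1−δ_{x,0}) P̃(0⇔x)` (row `a = b = 0 (⇒ x = y, v = 0)`: `(1−δ_{0,x}) P(0⇔x)`).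
[cite: FitznerVanDerHofstad2017, App. B Table "definition of A^{a,b}(0,v,x,y)", row (0,0) (arXiv:1506.07977v2 p. 74); §5.1 "Elements of the bounds" (p. 49)] -/
theorem matA_zero_zero : matA L 0 0 = ∑' x, kdc x 0 * L.pdbc x := by
  have h : ∀ v x y, blockA L 0 0 0 v x y = kd x y * kd v 0 * (kdc x 0 * L.pdbc x) := fun v x y => by
    rw [blockA, ofBase_zero]; rfl
  rw [matA, matB₀_apply, normB_eq_of_v_zero _ fun v hv x y => by rw [h, kd_of_ne hv]; simp]
  simp only [h, kd_self, mul_one, ENNReal.tsum_mul_right, tsum_kd, one_mul]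

/-- `(A)_{0,1} = Σ_{x,y} (1−δ_{y,0}) T_{1,1̲,1}(x,y,0)` (row `a = 0, b = 1 (⇒ v = 0, y ≠ v)`).
[cite: FitznerVanDerHofstad2017, App. B Table "definition of A^{a,b}(0,v,x,y)", row (0,1) (arXiv:1506.07977v2 p. 74); §5.1 "Elements of the bounds" (p. 49)] -/
theorem matA_zero_one : matA L 0 1 = ∑' x, ∑' y, kdc y 0 * L.T (.ge 1) (.eq 1) (.ge 1) x y 0 := by
  have h : ∀ v x y, blockA L 0 1 0 v x y = kd v 0 * kdc y v * L.T (.ge 1) (.eq 1) (.ge 1) x y 0 := fun v x y => by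
    rw [blockA, ofBase_zero]; rfl
  rw [matA, matB₀_apply, normB_eq_of_v_zero _ fun v hv x y => by rw [h, kd_of_ne hv]; simp]
  simp only [h, kd_self, one_mul]

/-- `(A)_{0,2} = Σ_{x,y} (1−δ_{y,0})(1−δ_{x,0}) T_{1,2,1}(x,y,0)` (row `a = 0, b ≥ 2 (⇒ v = 0, y ≠ 0, x ≠ 0)`).
[cite: FitznerVanDerHofstad2017, App. B Table "definition of A^{a,b}(0,v,x,y)", row (0,2) (arXiv:1506.07977v2 p. 74); §5.1 "Elements of the bounds" (p. 49)] -/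
theorem matA_zero_two :
    matA L 0 2 = ∑' x, ∑' y, kdc y 0 * kdc x 0 * L.T (.ge 1) (.ge 2) (.ge 1) x y 0 := by
  have h : ∀ v x y, blockA L 0 2 0 v x y =
      kd v 0 * kdc y 0 * kdc x 0 * L.T (.ge 1) (.ge 2) (.ge 1) x y 0 := fun v x y => by
    rw [blockA, ofBase_zero]; rfl
  rw [matA, matB₀_apply, normB_eq_of_v_zero _ fun v hv x y => by rw [h, kd_of_ne hv]; simp]
  simp only [h, kd_self, one_mul]

/-- `(A^ι)_{0,0} = Σ_x Σ_κ (1−δ_{0,x})(1−δ_{x,e_κ}) T_{1,1̲,1}(e_κ,x,0)` (App. B row `a = b = 0 (⇒ x = y, v = 0 ⇒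
v ≠ y, x ≠ e)`, the landed reading). [cite: FitznerVanDerHofstad2017, App. B Table "definition of A^{ι,a,b}(0,v,x,y)", row (0,0) (arXiv:1506.07977v2 p. 75); §5.1 "Elements of the bounds" (p. 49)] -/
theorem matAiota_zero_zero : matAiota L 0 0 =
    ∑' x, ∑ κ : Fin d × Bool, kdc 0 x * kdc x (𝐞 κ) * L.T (.ge 1) (.eq 1) (.ge 1) (𝐞 κ) x 0 := by
  have h : ∀ κ v x y, blockAiota L κ 0 0 0 v x y =
      kd x y * kd v 0 * kdc v y * kdc x (𝐞 κ) * L.T (.ge 1) (.eq 1) (.ge 1) (𝐞 κ) x 0 := fun κ v x y => by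
    rw [blockAiota, ofBase_zero]; rfl
  rw [matAiota, matB_apply,
    iSup_eq_apply_zero (fun v => ∑' x, ∑' y, ∑ κ, blockAiota L κ 0 0 0 v x y) fun v hv => by
      simp [h, kd_of_ne hv]]
  refine tsum_congr fun x => ?_
  rw [tsum_eq_single x fun y hy => by simp [h, kd_of_ne (Ne.symm hy)]]
  simp [h]

/-- `(A^ι)_{0,1} = Σ_{x,y} Σ_κ (1−δ_{y,0}) [δ_{x,e_κ} T_{1̲,1̲,2}(e_κ,y,0) + S_{1̲,1,1̲,1}(e_κ,x,y,0)]` (row `a = 0,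
b = 1 (⇒ v = 0 ⇒ v ≠ y)`). [cite: FitznerVanDerHofstad2017, App. B Table "definition of A^{ι,a,b}(0,v,x,y)", row (0,1) (arXiv:1506.07977v2 p. 75); §5.1 "Elements of the bounds" (p. 49)] -/
theorem matAiota_zero_one : matAiota L 0 1 =
    ∑' x, ∑' y, ∑ κ : Fin d × Bool, kdc y 0 *
      (kd x (𝐞 κ) * L.T (.eq 1) (.eq 1) (.ge 2) (𝐞 κ) y 0 + L.S (.eq 1) (.ge 1) (.eq 1) (.ge 1) (𝐞 κ) x y 0) := by
  have h : ∀ κ v x y, blockAiota L κ 0 1 0 v x y = kd v 0 * kdc y v *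
      (kd x (𝐞 κ) * L.T (.eq 1) (.eq 1) (.ge 2) (𝐞 κ) y 0 + L.S (.eq 1) (.ge 1) (.eq 1) (.ge 1) (𝐞 κ) x y 0) :=
    fun κ v x y => by rw [blockAiota, ofBase_zero]; rfl
  rw [matAiota, matB_apply,
    iSup_eq_apply_zero (fun v => ∑' x, ∑' y, ∑ κ, blockAiota L κ 0 1 0 v x y) fun v hv => by
      simp [h, kd_of_ne hv]]
  simp only [h, kd_self, one_mul]

/-- `(A^ι)_{0,2} = Σ_{x,y} Σ_κ (1−δ_{y,0})(1−δ_{x,0}) S_{1̲,0,2,1}(e_κ,x,y,0)` (row `a = 0, b = 2 (⇒ v = 0 ⇒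
v ≠ y)`). [cite: FitznerVanDerHofstad2017, App. B Table "definition of A^{ι,a,b}(0,v,x,y)", row (0,2) (arXiv:1506.07977v2 p. 75); §5.1 "Elements of the bounds" (p. 49)] -/
theorem matAiota_zero_two : matAiota L 0 2 =
    ∑' x, ∑' y, ∑ κ : Fin d × Bool, kdc y 0 * kdc x 0 * L.S (.eq 1) (.ge 0) (.ge 2) (.ge 1) (𝐞 κ) x y 0 := by
  have h : ∀ κ v x y, blockAiota L κ 0 2 0 v x y =
      kd v 0 * kdc y 0 * kdc x 0 * L.S (.eq 1) (.ge 0) (.ge 2) (.ge 1) (𝐞 κ) x y 0 :=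
    fun κ v x y => by rw [blockAiota, ofBase_zero]; rfl
  rw [matAiota, matB_apply,
    iSup_eq_apply_zero (fun v => ∑' x, ∑' y, ∑ κ, blockAiota L κ 0 2 0 v x y) fun v hv => by
      simp [h, kd_of_ne hv]]
  simp only [h, kd_self, one_mul]

/-- `(Ā^ι)_{0,0} = Σ_x Σ_κ (1−δ_{0,x})(1−δ_{x,e_κ}) T_{1,1̲,1}(e_κ,x,0)` — both suprema of `sup_{v,y} Σ_{κ,x}
Ā^{κ,0,0}(0,v,x,x+y)` are attained at `v = 0`, `y = 0` (`Ā^{ι,a,0} = A^{ι,a,0}`, App. B p. 78; landed reading of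
the row `(0,0)`, App. B p. 75). [cite: FitznerVanDerHofstad2017, App. B Tables "A^{ι,a,b}" row (0,0) and "Ā^{ι,a,b}" (arXiv:1506.07977v2 pp. 75, 78); §5.1 "Elements of the bounds" (p. 49); (6.5) (p. 58)] -/
theorem matAbarIota_zero_zero : matAbarIota L 0 0 =
    ∑' x, ∑ κ : Fin d × Bool, kdc 0 x * kdc x (𝐞 κ) * L.T (.ge 1) (.eq 1) (.ge 1) (𝐞 κ) x 0 := by
  have h : ∀ κ v x y, blockAbar L κ 0 0 0 v x y =
      kd x y * kd v 0 * kdc v y * kdc x (𝐞 κ) * L.T (.ge 1) (.eq 1) (.ge 1) (𝐞 κ) x 0 := fun κ v x y => by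
    rw [blockAbar, ofBase_zero]; rfl
  rw [matAbarIota, matAbar_apply,
    iSup_eq_apply_zero (fun v => ⨆ y, ∑' x, ∑ κ, blockAbar L κ 0 0 0 v x (x + y)) fun v hv => by
      simp [h, kd_of_ne hv],
    iSup_eq_apply_zero (fun y => ∑' x, ∑ κ, blockAbar L κ 0 0 0 0 x (x + y)) fun y hy => by
      have hx : ∀ x : Site d, kd x (x + y) = 0 := fun x => kd_of_ne fun e => hy (by simpa using e.symm)
      simp [h, hx]]
  simp [h]

/-- `(Ā^{ι}')_{0,0} = Σ_x Σ_κ (1−δ_{0,x})(1−δ_{x,e_κ}) T_{1̲,1,1}(e_κ,x,0)` — the same collapse for the primed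
element of `NobleBlocksPrime` (§6.1 reading of the row `(0,0)`: "`T_{1̲,1,1}(e_ι,t−u,0) = Ā^{ι,0,0}(u,u,t,t)`").
[cite: FitznerVanDerHofstad2017, §6.1 Case a = 0, b = 0 (arXiv:1506.07977v2 p. 59); §5.1 "Elements of the bounds" (p. 49); (6.5) (p. 58)] -/
theorem matAbarIota'_zero_zero : matAbarIota' L 0 0 =
    ∑' x, ∑ κ : Fin d × Bool, kdc 0 x * kdc x (𝐞 κ) * L.T (.eq 1) (.ge 1) (.ge 1) (𝐞 κ) x 0 := by
  have h : ∀ κ v x y, blockAbar' L κ 0 0 0 v x y =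
      kd x y * kd v 0 * kdc v y * kdc x (𝐞 κ) * L.T (.eq 1) (.ge 1) (.ge 1) (𝐞 κ) x 0 := fun κ v x y => by
    rw [blockAbar', ofBase_zero, blockAbar₀'_zero_zero]
  rw [matAbarIota', matAbar_apply,
    iSup_eq_apply_zero (fun v => ⨆ y, ∑' x, ∑ κ, blockAbar' L κ 0 0 0 v x (x + y)) fun v hv => by
      simp [h, kd_of_ne hv],
    iSup_eq_apply_zero (fun y => ∑' x, ∑ κ, blockAbar' L κ 0 0 0 0 x (x + y)) fun y hy => by
      have hx : ∀ x : Site d, kd x (x + y) = 0 := fun x => kd_of_ne fun e => hy (by simpa using e.symm)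
      simp [h, hx]]
  simp [h]

/-- `(Ā^ι)_{0,1} = sup_y Σ_x Σ_κ p⁻¹ (1−δ_{x+y,0}) [δ_{x,e_κ} T_{1̲,1̲,2}(e_κ,x+y,0) + S_{1̲,1,1̲,1}(e_κ,x,x+y,0)]` —
the supremum over `v` is attained at `v = 0`, the one over the out-gap `y` survives (`Ā^{ι,a,1} = p⁻¹ A^{ι,a,1}`,
App. B p. 78). [cite: FitznerVanDerHofstad2017, App. B Tables "A^{ι,a,b}" row (0,1) and "Ā^{ι,a,b}" (arXiv:1506.07977v2 pp. 75, 78); §5.1 "Elements of the bounds" (p. 49); (6.5) (p. 58)] -/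
theorem matAbarIota_zero_one : matAbarIota L 0 1 =
    ⨆ y, ∑' x, ∑ κ : Fin d × Bool, L.p⁻¹ * (kdc (x + y) 0 *
      (kd x (𝐞 κ) * L.T (.eq 1) (.eq 1) (.ge 2) (𝐞 κ) (x + y) 0 + L.S (.eq 1) (.ge 1) (.eq 1) (.ge 1) (𝐞 κ) x (x + y) 0)) := by
  have h : ∀ κ v x y, blockAbar L κ 0 1 0 v x y = L.p⁻¹ * (kd v 0 * kdc y v *
      (kd x (𝐞 κ) * L.T (.eq 1) (.eq 1) (.ge 2) (𝐞 κ) y 0 + L.S (.eq 1) (.ge 1) (.eq 1) (.ge 1) (𝐞 κ) x y 0)) :=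
    fun κ v x y => by rw [blockAbar, ofBase_zero]; rfl
  rw [matAbarIota, matAbar_apply,
    iSup_eq_apply_zero (fun v => ⨆ y, ∑' x, ∑ κ, blockAbar L κ 0 1 0 v x (x + y)) fun v hv => by
      simp [h, kd_of_ne hv]]
  simp only [h, kd_self, one_mul]

/-- `(A^*)_{0,0} = (A)_{0,0} = Σ_x (1−δ_{x,0}) P̃(0⇔x)` (row `b = 0` is repulsive in `A^{a,b,*}` too).
[cite: FitznerVanDerHofstad2017, §5.1 Table "Open non-repulsive diagram A^{a,b,*}" (arXiv:1506.07977v2 p. 47); App. B (p. 74)] -/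
theorem matAst_zero_zero : matAst L 0 0 = ∑' x, kdc x 0 * L.pdbc x := by
  have h : ∀ v x y, blockAst L 0 0 0 v x y = kd x y * kd v 0 * (kdc x 0 * L.pdbc x) := fun v x y => by
    rw [blockAst, ofBase_zero]; rfl
  rw [matAst, matB₀_apply, normB_eq_of_v_zero _ fun v hv x y => by rw [h, kd_of_ne hv]; simp]
  simp only [h, kd_self, mul_one, ENNReal.tsum_mul_right, tsum_kd, one_mul]

/-- `(A^*)_{0,1} = Σ_{x,y} (1−δ_{y,0}) T^*_{1,1̲,1}(x,y,0)`.
[cite: FitznerVanDerHofstad2017, §5.1 Table "Open non-repulsive diagram A^{a,b,*}" (arXiv:1506.07977v2 p. 47); App. B (p. 74)] -/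
theorem matAst_zero_one : matAst L 0 1 = ∑' x, ∑' y, kdc y 0 * L.Tst (.ge 1) (.eq 1) (.ge 1) x y 0 := by
  have h : ∀ v x y, blockAst L 0 1 0 v x y = kd v 0 * kdc y v * L.Tst (.ge 1) (.eq 1) (.ge 1) x y 0 :=
    fun v x y => by rw [blockAst, ofBase_zero]; rfl
  rw [matAst, matB₀_apply, normB_eq_of_v_zero _ fun v hv x y => by rw [h, kd_of_ne hv]; simp]
  simp only [h, kd_self, one_mul]

/-- `(A^*)_{0,2} = Σ_{x,y} (1−δ_{y,0})(1−δ_{x,0}) T^*_{1,2,1}(x,y,0)`.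
[cite: FitznerVanDerHofstad2017, §5.1 Table "Open non-repulsive diagram A^{a,b,*}" (arXiv:1506.07977v2 p. 47); App. B (p. 74)] -/
theorem matAst_zero_two :
    matAst L 0 2 = ∑' x, ∑' y, kdc y 0 * kdc x 0 * L.Tst (.ge 1) (.ge 2) (.ge 1) x y 0 := by
  have h : ∀ v x y, blockAst L 0 2 0 v x y =
      kd v 0 * kdc y 0 * kdc x 0 * L.Tst (.ge 1) (.ge 2) (.ge 1) x y 0 := fun v x y => by
    rw [blockAst, ofBase_zero]; rfl
  rw [matAst, matB₀_apply, normB_eq_of_v_zero _ fun v hv x y => by rw [h, kd_of_ne hv]; simp]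
  simp only [h, kd_self, one_mul]

/-- `(A^{ι,*})_{0,0} = (A^ι)_{0,0}`'s letter form (row `b = 0` repulsive).
[cite: FitznerVanDerHofstad2017, App. B, sentence after Table "definition of A^{ι,a,b}" (arXiv:1506.07977v2 p. 75); §5.1 (p. 49)] -/
theorem matAiotaSt_zero_zero : matAiotaSt L 0 0 =
    ∑' x, ∑ κ : Fin d × Bool, kdc 0 x * kdc x (𝐞 κ) * L.T (.ge 1) (.eq 1) (.ge 1) (𝐞 κ) x 0 := by
  have h : ∀ κ v x y, blockAiotaSt L κ 0 0 0 v x y =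
      kd x y * kd v 0 * kdc v y * kdc x (𝐞 κ) * L.T (.ge 1) (.eq 1) (.ge 1) (𝐞 κ) x 0 := fun κ v x y => by
    rw [blockAiotaSt, ofBase_zero]; rfl
  rw [matAiotaSt, matB_apply,
    iSup_eq_apply_zero (fun v => ∑' x, ∑' y, ∑ κ, blockAiotaSt L κ 0 0 0 v x y) fun v hv => by
      simp [h, kd_of_ne hv]]
  refine tsum_congr fun x => ?_
  rw [tsum_eq_single x fun y hy => by simp [h, kd_of_ne (Ne.symm hy)]]
  simp [h]

/-- `(A^{ι,*})_{0,1} = Σ_{x,y} Σ_κ (1−δ_{y,0}) [δ_{x,e_κ} T^*_{1̲,1̲,2}(e_κ,y,0) + S^*_{1̲,1,1̲,1}(e_κ,x,y,0)]`.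
[cite: FitznerVanDerHofstad2017, App. B, sentence after Table "definition of A^{ι,a,b}" (arXiv:1506.07977v2 p. 75); §5.1 (p. 49)] -/
theorem matAiotaSt_zero_one : matAiotaSt L 0 1 =
    ∑' x, ∑' y, ∑ κ : Fin d × Bool, kdc y 0 *
      (kd x (𝐞 κ) * L.Tst (.eq 1) (.eq 1) (.ge 2) (𝐞 κ) y 0 + L.Sst (.eq 1) (.ge 1) (.eq 1) (.ge 1) (𝐞 κ) x y 0) := by
  have h : ∀ κ v x y, blockAiotaSt L κ 0 1 0 v x y = kd v 0 * kdc y v *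
      (kd x (𝐞 κ) * L.Tst (.eq 1) (.eq 1) (.ge 2) (𝐞 κ) y 0 + L.Sst (.eq 1) (.ge 1) (.eq 1) (.ge 1) (𝐞 κ) x y 0) :=
    fun κ v x y => by rw [blockAiotaSt, ofBase_zero]; rfl
  rw [matAiotaSt, matB_apply,
    iSup_eq_apply_zero (fun v => ∑' x, ∑' y, ∑ κ, blockAiotaSt L κ 0 1 0 v x y) fun v hv => by
      simp [h, kd_of_ne hv]]
  simp only [h, kd_self, one_mul]

/-- `(A^{ι,*})_{0,2} = Σ_{x,y} Σ_κ (1−δ_{y,0})(1−δ_{x,0}) S^*_{1̲,0,2,1}(e_κ,x,y,0)`.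
[cite: FitznerVanDerHofstad2017, App. B, sentence after Table "definition of A^{ι,a,b}" (arXiv:1506.07977v2 p. 75); §5.1 (p. 49)] -/
theorem matAiotaSt_zero_two : matAiotaSt L 0 2 =
    ∑' x, ∑' y, ∑ κ : Fin d × Bool, kdc y 0 * kdc x 0 * L.Sst (.eq 1) (.ge 0) (.ge 2) (.ge 1) (𝐞 κ) x y 0 := by
  have h : ∀ κ v x y, blockAiotaSt L κ 0 2 0 v x y =
      kd v 0 * kdc y 0 * kdc x 0 * L.Sst (.eq 1) (.ge 0) (.ge 2) (.ge 1) (𝐞 κ) x y 0 :=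
    fun κ v x y => by rw [blockAiotaSt, ofBase_zero]; rfl
  rw [matAiotaSt, matB_apply,
    iSup_eq_apply_zero (fun v => ∑' x, ∑' y, ∑ κ, blockAiotaSt L κ 0 2 0 v x y) fun v hv => by
      simp [h, kd_of_ne hv]]
  simp only [h, kd_self, one_mul]

/-- `(Ā^ι)_{0,2} = sup_y Σ_x Σ_κ T^*_{1,1̲,0}(−(x+y), e_κ−(x+y), −y)` (row `a = 0, b = 2 (⇒ v = 0)`:
`T^*_{1,1̲,0}(−y, e−y, x−y)` at `(0,v,x,x+y)`; the supremum over the out-gap survives).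
[cite: FitznerVanDerHofstad2017, App. B Table "definition of Ā^{ι,a,b}(0,v,x,y)", row (0,2) (arXiv:1506.07977v2 p. 78); §5.1 "Elements of the bounds" (p. 49); (6.5) (p. 58)] -/
theorem matAbarIota_zero_two : matAbarIota L 0 2 =
    ⨆ y, ∑' x, ∑ κ : Fin d × Bool, L.Tst (.ge 1) (.eq 1) (.ge 0) (-(x + y)) (𝐞 κ - (x + y)) (-y) := by
  have h : ∀ κ v x y, blockAbar L κ 0 2 0 v x y =
      kd v 0 * L.Tst (.ge 1) (.eq 1) (.ge 0) (-y) (𝐞 κ - y) (x - y) := fun κ v x y => by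
    rw [blockAbar, ofBase_zero]; rfl
  rw [matAbarIota, matAbar_apply,
    iSup_eq_apply_zero (fun v => ⨆ y, ∑' x, ∑ κ, blockAbar L κ 0 2 0 v x (x + y)) fun v hv => by
      simp [h, kd_of_ne hv]]
  simp only [h, kd_self, one_mul, sub_add_cancel_left]

/-- `(Ā^{ι,*})_{0,0}`: the same closed form as `(Ā^ι)_{0,0}` (row `b = 0` repulsive, `Ā^{ι,a,0,*} = Ā^{ι,a,0}`).
[cite: FitznerVanDerHofstad2017, §5.1 Table "Ā^{ι,a,b,*}" (arXiv:1506.07977v2 p. 47); App. B (pp. 75, 78)] -/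
theorem matAbarIotaSt_zero_zero : matAbarIotaSt L 0 0 =
    ∑' x, ∑ κ : Fin d × Bool, kdc 0 x * kdc x (𝐞 κ) * L.T (.ge 1) (.eq 1) (.ge 1) (𝐞 κ) x 0 := by
  have h : ∀ κ v x y, blockAbarSt L κ 0 0 0 v x y =
      kd x y * kd v 0 * kdc v y * kdc x (𝐞 κ) * L.T (.ge 1) (.eq 1) (.ge 1) (𝐞 κ) x 0 := fun κ v x y => by
    rw [blockAbarSt, ofBase_zero]; rfl
  rw [matAbarIotaSt, matAbar_apply,
    iSup_eq_apply_zero (fun v => ⨆ y, ∑' x, ∑ κ, blockAbarSt L κ 0 0 0 v x (x + y)) fun v hv => by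
      simp [h, kd_of_ne hv],
    iSup_eq_apply_zero (fun y => ∑' x, ∑ κ, blockAbarSt L κ 0 0 0 0 x (x + y)) fun y hy => by
      have hx : ∀ x : Site d, kd x (x + y) = 0 := fun x => kd_of_ne fun e => hy (by simpa using e.symm)
      simp [h, hx]]
  simp [h]

/-- `(Ā^{ι,*})_{0,1} = sup_y Σ_x Σ_κ p⁻¹ (1−δ_{x+y,0}) [δ_{x,e_κ} T^*_{1̲,1̲,2}(e_κ,x+y,0) + S^*_{1̲,1,1̲,1}(e_κ,x,x+y,0)]`
(`Ā^{ι,a,1,*} = p⁻¹ A^{ι,a,1,*}`). [cite: FitznerVanDerHofstad2017, §5.1 Table "Ā^{ι,a,b,*}" (arXiv:1506.07977v2 p. 47); App. B (pp. 75, 78); (6.5) (p. 58)] -/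
theorem matAbarIotaSt_zero_one : matAbarIotaSt L 0 1 =
    ⨆ y, ∑' x, ∑ κ : Fin d × Bool, L.p⁻¹ * (kdc (x + y) 0 *
      (kd x (𝐞 κ) * L.Tst (.eq 1) (.eq 1) (.ge 2) (𝐞 κ) (x + y) 0 +
        L.Sst (.eq 1) (.ge 1) (.eq 1) (.ge 1) (𝐞 κ) x (x + y) 0)) := by
  have h : ∀ κ v x y, blockAbarSt L κ 0 1 0 v x y = L.p⁻¹ * (kd v 0 * kdc y v *
      (kd x (𝐞 κ) * L.Tst (.eq 1) (.eq 1) (.ge 2) (𝐞 κ) y 0 + L.Sst (.eq 1) (.ge 1) (.eq 1) (.ge 1) (𝐞 κ) x y 0)) :=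
    fun κ v x y => by rw [blockAbarSt, ofBase_zero]; rfl
  rw [matAbarIotaSt, matAbar_apply,
    iSup_eq_apply_zero (fun v => ⨆ y, ∑' x, ∑ κ, blockAbarSt L κ 0 1 0 v x (x + y)) fun v hv => by
      simp [h, kd_of_ne hv]]
  simp only [h, kd_self, one_mul]

/-- `(Ā^{ι,*})_{0,2} = (Ā^ι)_{0,2}`'s form (row `b ≥ 2` already non-repulsive).
[cite: FitznerVanDerHofstad2017, §5.1 Table "Ā^{ι,a,b,*}" (arXiv:1506.07977v2 p. 47); App. B (p. 78); (6.5) (p. 58)] -/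
theorem matAbarIotaSt_zero_two : matAbarIotaSt L 0 2 =
    ⨆ y, ∑' x, ∑ κ : Fin d × Bool, L.Tst (.ge 1) (.eq 1) (.ge 0) (-(x + y)) (𝐞 κ - (x + y)) (-y) := by
  have h : ∀ κ v x y, blockAbarSt L κ 0 2 0 v x y =
      kd v 0 * L.Tst (.ge 1) (.eq 1) (.ge 0) (-y) (𝐞 κ - y) (x - y) := fun κ v x y => by
    rw [blockAbarSt, ofBase_zero]; rfl
  rw [matAbarIotaSt, matAbar_apply,
    iSup_eq_apply_zero (fun v => ⨆ y, ∑' x, ∑ κ, blockAbarSt L κ 0 2 0 v x (x + y)) fun v hv => by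
      simp [h, kd_of_ne hv]]
  simp only [h, kd_self, one_mul, sub_add_cancel_left]

/-- `(Ā^{ι,*}')_{0,0} = (Ā^{ι}')_{0,0}`'s form — the primed non-repulsive element of `NobleBlocksPrime` in the
row `(0,0)` (§6.1 reading `T_{1̲,1,1}`). [cite: FitznerVanDerHofstad2017, §6.1 Case a = 0, b = 0 (arXiv:1506.07977v2 p. 59); §5.1 (pp. 47, 49)] -/
theorem matAbarIotaSt'_zero_zero : matAbarIotaSt' L 0 0 =
    ∑' x, ∑ κ : Fin d × Bool, kdc 0 x * kdc x (𝐞 κ) * L.T (.eq 1) (.ge 1) (.ge 1) (𝐞 κ) x 0 := by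
  have h : ∀ κ v x y, blockAbarSt' L κ 0 0 0 v x y =
      kd x y * kd v 0 * kdc v y * kdc x (𝐞 κ) * L.T (.eq 1) (.ge 1) (.ge 1) (𝐞 κ) x 0 := fun κ v x y => by
    rw [blockAbarSt', ofBase_zero, blockAbarSt₀'_zero_zero]
  rw [matAbarIotaSt', matAbar_apply,
    iSup_eq_apply_zero (fun v => ⨆ y, ∑' x, ∑ κ, blockAbarSt' L κ 0 0 0 v x (x + y)) fun v hv => by
      simp [h, kd_of_ne hv],
    iSup_eq_apply_zero (fun y => ∑' x, ∑ κ, blockAbarSt' L κ 0 0 0 0 x (x + y)) fun y hy => by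
      have hx : ∀ x : Site d, kd x (x + y) = 0 := fun x => kd_of_ne fun e => hy (by simpa using e.symm)
      simp [h, hx]]
  simp [h]

/-- The D74 pair differs only in the length indices of the triangle letter: `(Ā^ι)_{0,0}` and `(Ā^{ι}')_{0,0}` are
the same Kronecker-weighted `κ,x`-sum of `T_{1,1̲,1}(e_κ,x,0)` resp. `T_{1̲,1,1}(e_κ,x,0)`; in particular they
coincide for any letter table whose triangle is symmetric in its first two length indices at these arguments.
[cite: FitznerVanDerHofstad2017, §6.1 Case a = 0, b = 0 (arXiv:1506.07977v2 p. 59); App. B Table "A^{ι,a,b}" row (0,0) (p. 75)] -/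
theorem matAbarIota'_zero_zero_eq_of_T_symm
    (hT : ∀ κ : Fin d × Bool, ∀ x : Site d,
      L.T (.eq 1) (.ge 1) (.ge 1) (𝐞 κ) x 0 = L.T (.ge 1) (.eq 1) (.ge 1) (𝐞 κ) x 0) :
    matAbarIota' L 0 0 = matAbarIota L 0 0 := by
  rw [matAbarIota'_zero_zero, matAbarIota_zero_zero]
  simp only [hT]

end Rows

end Literature.Probability.FitznerVanDerHofstad2017.NobleBlocks

end
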